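import Literature.Algebra.Polynomial.CasasAlvero.Degree8Char811Closed
import Literature.Algebra.Polynomial.CasasAlvero.Degree8ScenarioCriterion
import Mathlib.Tactic.NormNum.Prime
import HarnessLib

/-!
# The Casas-Alvero conjecture in degree 8 holds in characteristic 811

This file PROVES, kernel-checked, that `811` is a GOOD prime for degree `8` in the sense of [CastryckLaterveerOunaies2012]
(`CA_8` holds in characteristic `811`):

* `holdsInDegree_eight_of_char_811` — `CA_8` over every field with `811 = 0`: the `876` reduced scenario systems are closed there
  (`degree8ScenariosClosed_of_char_811`, assembled from the kernel-evaluated certificates `Degree8Char811Cert*.lean` via `CertCheck.check`),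
  and the characteristic-free criterion `Degree8ScenariosClosed.holdsInDegree_eight` (`Degree8ScenarioCriterion.lean`) applies;
* `holdsInDegree_eight_mul_pow_of_char_811` — hence `CA_(8·811^k)` over every field of characteristic `811` ([GrafVonBothmerEtAl2007, Prop. 6] + descent).

`811` is the second prime (after `257`) that is bad for degree `6` (`Degree6BadPrimes.lean`) and it is good for degree `7`
(`Degree7Char811.lean`), so with this file its Casas-Alvero digit set contains `7` and `8` but not `6` — the first classification of that shape in this library
(the primes `601 ≤ p ≤ 809` are not classified here).
The certificates were found by linear algebra over `F_811` (lottery cell `code/L4lean-g15/d8/certD.py`, unchanged, kit job j174973) and are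
re-verified here by the kernel; two further independent implementations (chain certificates from a recording Buchberger,
`code/L4lean-g19/implE/certE.py`, kit job j174932, all `876` scenarios certified; Gröbner bases after elimination,
`code/L4lean-g18/implC/implD_elim.py`, kit job j175014, `877/877` scenarios closed) report every degree-8 scenario closed at `p = 811` as well,
and a witness-first search finds no Casas-Alvero octic over `F_811` with `F_811`-rational witnesses (kit job j174934).  No `sorry`, no new axioms.
-/

set_option linter.style.longLine false

noncomputable section

open Polynomial

namespace Literature.Algebra.Polynomial.CasasAlvero

variable {K : Type*} [Field K]

/-- **`CA_8` in characteristic `811`.**  Over every field in which `811 = 0`, a monic polynomial of degree `8` each of whose Hasse derivatives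
`H_1 f, …, H_7 f` shares a root with `f` is `(X - a)^8`: `811` is a good prime for degree `8` (it is bad for degree `6` (`Degree6BadPrimes.lean`, the second such prime after `257`) yet good for degree `7` (`Degree7Char811.lean`)).
[cite: CastryckLaterveerOunaies2012, Sec. 2] -/
theorem holdsInDegree_eight_of_char_811 (hp : (811 : K) = 0) : HoldsInDegree K 8 :=
  (degree8ScenariosClosed_of_char_811 hp).holdsInDegree_eight

/-- Hence `CA_(8·811^k)` over every field of characteristic `811`. [cite: CastryckLaterveerOunaies2012, Sec. 2] [cite: GrafVonBothmerEtAl2007, Prop. 6] -/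
theorem holdsInDegree_eight_mul_pow_of_char_811 [CharP K 811] (k : ℕ) : HoldsInDegree K (8 * 811 ^ k) := by
  haveI : Fact (Nat.Prime 811) := ⟨by norm_num⟩
  exact Degree8ScenariosClosed.holdsInDegree_eight_mul_prime_pow 811
    (degree8ScenariosClosed_of_char_811 (K := AlgebraicClosure K) (by simpa using CharP.cast_eq_zero (AlgebraicClosure K) 811)) k

end Literature.Algebra.Polynomial.CasasAlvero
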